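import Summits.CriticalPhenomena.SAWScalingLimit.Theorems.SAWLeftRightFKGLeftRightFKGTP2Defs
import HarnessLib

/-!
# Stub `stub_cornerAssembly` of line `corner-localisation` (lead c1 reshape v5), helper file 1: finite-sum algebra

Crux `LeftRightFKG` (stmt-CriticalPhenomena-11232). The assembly proves corner positivity of a prefix/suffix class
from the signs of the `2 × 2` minors of its end-step matrix. This file holds the fugacity-blind bookkeeping, in
abstract form (a finite set `s` of weighted items, a "next step" label `f : ι → α` and a "previous step" label
`g : ι → β`):

* `block_of_termwise`: if every crossed product of matrix entries is at most the corresponding nested product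
  (`Z u w' · Z u' w ≤ Z u w · Z u' w'` for `u ∈ E ∌ u'`, `w ∈ F ∌ w'`), then the block inequality
  `Z(E × all) · Z(all × F) ≤ Z(all × all) · Z(E × F)` holds (expand, cancel, compare termwise);
* `sum_filter_eq_sum_dir`: a filtered item sum is the double sum, over next-step and previous-step labels, of
  the entries `Z u w = Σ_{f γ = u, g γ = w} wt γ`;
* `corner_of_remove`: adjoining ONE item that is comparable with everything (the direct chord) preserves the
  corner inequality — the four membership cases;
* `sum_filter_add_sum_filter_le`: inclusion–exclusion bound `w(A) + w(B) ≤ w(all) + w(A ∩ B)`;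
* `sum_filter_insert'`: splitting off an inserted item from a filtered sum.
-/

noncomputable section

open Finset
open Literature.Probability.LatticeModels Literature.Probability.RandomPlanarGeometry
open scoped Classical

namespace Summit.CriticalPhenomena.SAWScalingLimit.Theorems.LeftRightFKG.CornerLoc

namespace CornerAssembly

section Abstract

variable {ι α β : Type*}

/-- BLOCK INEQUALITY FROM TERMWISE TP₂: for nonnegative entries `Z u w` indexed by `U × W`, a row event `E` and a
column event `F`, if `Z u w' · Z u' w ≤ Z u w · Z u' w'` whenever `u ∈ E`, `u' ∉ E`, `w ∈ F`, `w' ∉ F`, then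
`(Σ_{E×W} Z)(Σ_{U×F} Z) ≤ (Σ_{U×W} Z)(Σ_{E×F} Z)`. With `p, q, r, s` the four blocks this is
`(p+q)(p+r) ≤ (p+q+r+s) p ⟸ q r ≤ p s`, and `q r ≤ p s` termwise. [folklore] -/
theorem block_of_termwise (U : Finset α) (W : Finset β) (E : α → Prop) (F : β → Prop) [DecidablePred E]
    [DecidablePred F] (Z : α → β → ℝ) (hZ : ∀ u ∈ U, ∀ w ∈ W, 0 ≤ Z u w)
    (hterm : ∀ u ∈ U, ∀ u' ∈ U, ∀ w ∈ W, ∀ w' ∈ W, E u → ¬ E u' → F w → ¬ F w' →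
      Z u w' * Z u' w ≤ Z u w * Z u' w') :
    (∑ u ∈ U.filter E, ∑ w ∈ W, Z u w) * (∑ u ∈ U, ∑ w ∈ W.filter F, Z u w) ≤
      (∑ u ∈ U, ∑ w ∈ W, Z u w) * (∑ u ∈ U.filter E, ∑ w ∈ W.filter F, Z u w) := by
  set p := ∑ u ∈ U.filter E, ∑ w ∈ W.filter F, Z u w with hp
  set q := ∑ u ∈ U.filter E, ∑ w ∈ W.filter (fun w => ¬ F w), Z u w with hq
  set r := ∑ u ∈ U.filter (fun u => ¬ E u), ∑ w ∈ W.filter F, Z u w with hr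
  set s := ∑ u ∈ U.filter (fun u => ¬ E u), ∑ w ∈ W.filter (fun w => ¬ F w), Z u w with hs
  have hrow : ∀ u ∈ U, ∑ w ∈ W, Z u w = (∑ w ∈ W.filter F, Z u w) + ∑ w ∈ W.filter (fun w => ¬ F w), Z u w :=
    fun u _ => (sum_filter_add_sum_filter_not W F _).symm
  have hA : ∑ u ∈ U.filter E, ∑ w ∈ W, Z u w = p + q := by
    rw [hp, hq, ← sum_add_distrib]
    exact sum_congr rfl fun u hu => hrow u (mem_filter.1 hu).1
  have hB : ∑ u ∈ U, ∑ w ∈ W.filter F, Z u w = p + r := by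
    rw [hp, hr]; exact (sum_filter_add_sum_filter_not U E _).symm
  have hT : ∑ u ∈ U, ∑ w ∈ W, Z u w = p + q + (r + s) := by
    rw [← sum_filter_add_sum_filter_not U E, hA]
    congr 1
    rw [hr, hs, ← sum_add_distrib]
    exact sum_congr rfl fun u hu => hrow u (mem_filter.1 hu).1
  have hqr : q * r ≤ p * s := by
    rw [hq, hr, hp, hs, sum_mul_sum, sum_mul_sum]
    refine sum_le_sum fun u hu => sum_le_sum fun u' hu' => ?_
    rw [sum_mul_sum, sum_mul_sum, sum_comm]
    refine sum_le_sum fun w hw => sum_le_sum fun w' hw' => ?_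
    have hu1 := mem_filter.1 hu; have hu2 := mem_filter.1 hu'
    have hw1 := mem_filter.1 hw; have hw2 := mem_filter.1 hw'
    exact hterm u hu1.1 u' hu2.1 w hw1.1 w' hw2.1 hu1.2 hu2.2 hw1.2 hw2.2
  have hp0 : 0 ≤ p := sum_nonneg fun u hu => sum_nonneg fun w hw =>
    hZ u (mem_filter.1 hu).1 w (mem_filter.1 hw).1
  have hq0 : 0 ≤ q := sum_nonneg fun u hu => sum_nonneg fun w hw =>
    hZ u (mem_filter.1 hu).1 w (mem_filter.1 hw).1
  have hr0 : 0 ≤ r := sum_nonneg fun u hu => sum_nonneg fun w hw =>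
    hZ u (mem_filter.1 hu).1 w (mem_filter.1 hw).1
  rw [hA, hB, hT]
  nlinarith [mul_nonneg hp0 hr0, mul_nonneg hq0 hp0]

/-- FIBERWISE DECOMPOSITION: an item sum filtered by a condition on the two labels is the double sum, over the
realised labels satisfying the conditions, of the entries `Σ_{f γ = u, g γ = w} wt γ`. [folklore] -/
theorem sum_filter_eq_sum_dir [DecidableEq α] [DecidableEq β] (s : Finset ι) (f : ι → α) (g : ι → β)
    (wt : ι → ℝ) (P : α → Prop) (Q : β → Prop) [DecidablePred P] [DecidablePred Q] :
    ∑ γ ∈ s.filter (fun γ => P (f γ) ∧ Q (g γ)), wt γ =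
      ∑ u ∈ (s.image f).filter P, ∑ w ∈ (s.image g).filter Q,
        ∑ γ ∈ s.filter (fun γ => f γ = u ∧ g γ = w), wt γ := by
  rw [← sum_fiberwise_of_maps_to (s := s.filter (fun γ => P (f γ) ∧ Q (g γ))) (t := (s.image f).filter P)
    (g := f) (fun γ hγ => by
      have h := mem_filter.1 hγ
      exact mem_filter.2 ⟨mem_image_of_mem f h.1, h.2.1⟩)]
  refine sum_congr rfl fun u hu => ?_
  rw [← sum_fiberwise_of_maps_to (s := (s.filter (fun γ => P (f γ) ∧ Q (g γ))).filter (fun γ => f γ = u))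
    (t := (s.image g).filter Q) (g := g) (fun γ hγ => by
      have h := mem_filter.1 (mem_filter.1 hγ).1
      exact mem_filter.2 ⟨mem_image_of_mem g h.1, h.2.2⟩)]
  refine sum_congr rfl fun w hw => sum_congr ?_ fun _ _ => rfl
  have hPu : P u := (mem_filter.1 hu).2
  have hQw : Q w := (mem_filter.1 hw).2
  ext γ
  simp only [mem_filter]
  constructor
  · rintro ⟨⟨⟨hs, -, -⟩, hf⟩, hg⟩
    exact ⟨hs, hf, hg⟩
  · rintro ⟨hs, hf, hg⟩
    exact ⟨⟨⟨hs, hf ▸ hPu, hg ▸ hQw⟩, hf⟩, hg⟩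

/-- The same decomposition without conditions on the labels. [folklore] -/
theorem sum_eq_sum_dir [DecidableEq α] [DecidableEq β] (s : Finset ι) (f : ι → α) (g : ι → β)
    (wt : ι → ℝ) :
    ∑ γ ∈ s, wt γ = ∑ u ∈ s.image f, ∑ w ∈ s.image g, ∑ γ ∈ s.filter (fun γ => f γ = u ∧ g γ = w), wt γ := by
  have h := sum_filter_eq_sum_dir s f g wt (fun _ => True) (fun _ => True)
  rwa [filter_true_of_mem (fun _ _ => ⟨trivial, trivial⟩), filter_true_of_mem (fun _ _ => trivial),
    filter_true_of_mem (fun _ _ => trivial)] at h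

/-- INCLUSION–EXCLUSION BOUND for nonnegative weights: `w(A) + w(B) ≤ w(all) + w(A ∩ B)`. [folklore] -/
theorem sum_filter_add_sum_filter_le (s : Finset ι) (wt : ι → ℝ) (hw : ∀ i ∈ s, 0 ≤ wt i) (A B : ι → Prop)
    [DecidablePred A] [DecidablePred B] :
    (∑ i ∈ s.filter A, wt i) + (∑ i ∈ s.filter B, wt i) ≤
      (∑ i ∈ s, wt i) + ∑ i ∈ (s.filter A).filter B, wt i := by
  have h1 : s.filter A ∪ s.filter B ⊆ s := union_subset (filter_subset _ _) (filter_subset _ _)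
  have h2 : s.filter A ∩ s.filter B = (s.filter A).filter B := by
    ext i; simp only [mem_inter, mem_filter]; tauto
  rw [← sum_union_inter, h2]
  exact add_le_add_left (sum_le_sum_of_subset_of_nonneg h1 fun i hi _ => hw i hi) _

/-- Splitting off an inserted item from a filtered sum. [folklore] -/
theorem sum_filter_insert' [DecidableEq ι] {s : Finset ι} {i₀ : ι} (hi₀ : i₀ ∉ s) (wt : ι → ℝ)
    (A : ι → Prop) [DecidablePred A] :
    ∑ i ∈ (insert i₀ s).filter A, wt i = (∑ i ∈ s.filter A, wt i) + if A i₀ then wt i₀ else 0 := by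
  rw [filter_insert]
  split_ifs with h
  · rw [sum_insert (fun h' => hi₀ (mem_filter.1 h').1), add_comm]
  · rw [add_zero]

/-- ADJOINING ONE ITEM COMPARABLE WITH EVERYTHING preserves the corner inequality. Blocks of the rest: `a = w(A)`,
`b = w(B)`, `c = w(A ∩ B)`, `t = w(all)` with `a b ≤ t c`, `a + b ≤ t + c`; the new item has weight `z ≥ 0` and
memberships `E₀`, `F₀`; comparability enters as: if the item is in `A ∖ B` then `B ⊆ A` on the rest (`b ≤ c`),
if it is in `B ∖ A` then `A ⊆ B` on the rest (`a ≤ c`). [folklore] -/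
theorem corner_of_remove {a b c t z : ℝ} (hc : 0 ≤ c) (hz : 0 ≤ z) (habt : a + b ≤ t + c)
    (h : a * b ≤ t * c) (E₀ F₀ : Prop) [Decidable E₀] [Decidable F₀]
    (hEF : E₀ → ¬ F₀ → b ≤ c) (hFE : F₀ → ¬ E₀ → a ≤ c) :
    (a + if E₀ then z else 0) * (b + if F₀ then z else 0) ≤
      (t + z) * (c + if E₀ ∧ F₀ then z else 0) := by
  by_cases hE : E₀ <;> by_cases hF : F₀ <;> simp [hE, hF]
  · nlinarith
  · have := hEF hE hF; nlinarith
  · have := hFE hF hE; nlinarith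
  · nlinarith

end Abstract

end CornerAssembly

/-- REGISTERED SUB-GOAL `stub_cornerAssemblyAux1` of stub `stub_cornerAssembly` (this helper file's pivot, recorded on
the crux item so that the file lands as a `--supports` proof): adjoining one item comparable with everything preserves
the corner inequality (`CornerAssembly.corner_of_remove`). [folklore] -/
theorem stub_cornerAssemblyAux1 : ∀ {a b c t z : ℝ}, 0 ≤ c → 0 ≤ z → a + b ≤ t + c → a * b ≤ t * c →
    ∀ (E₀ F₀ : Prop) [Decidable E₀] [Decidable F₀], (E₀ → ¬ F₀ → b ≤ c) → (F₀ → ¬ E₀ → a ≤ c) →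
    (a + if E₀ then z else 0) * (b + if F₀ then z else 0) ≤ (t + z) * (c + if E₀ ∧ F₀ then z else 0) :=
  fun hc hz habt h E₀ F₀ _ _ hEF hFE => CornerAssembly.corner_of_remove hc hz habt h E₀ F₀ hEF hFE

end Summit.CriticalPhenomena.SAWScalingLimit.Theorems.LeftRightFKG.CornerLoc

end
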